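import Summits.BirchSwinnertonDyer.BirchSwinnertonDyer.Theorems.GenusKolyvaginAtTwoGenusPrimitiveSupplyAtTwoTwistRamifiedTransversal
import Literature.NumberTheory.EllipticCurves.TorsionCardinality
import HarnessLib

/-!
# Route `GenusKolyvaginAtTwo`, crux #2 `GenusPrimitiveSupplyAtTwo` (stmt-BirchSwinnertonDyer-22136):
# Mazur–Rubin Cor. 3.4 (i) at `p = 2` with `dim V_T = 2` — the DOWN-BY-TWO transfer `#Sel₂(E^F) · 4 = #Sel₂(E)`
# at a prime where `E[2] ⊂ E(K_v)` and `loc_v` maps `Sel₂(E)` ONTO `H¹_f(K_v, E[2])` (the Selmer half of Prop. 5.2)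

Lead seat `bsd-line-gk2-p1` g8 (cell `bsd-f1-sign2`). THEOREMS ONLY (no definition, no named fact, no `sorry`); helper
`--supports stmt-BirchSwinnertonDyer-22136`; no item is closed; BSD is not proved by any of this.

WHY. The twin SUPPLY of the crux (stub A) rests on `MazurRubin2010.prop52_rat` (named print fact; gk2-p5 g0's binder
`hMR`): a prime twist lowering `d₂` by TWO. Its proof (Mazur–Rubin 2010 p. 12) is Cor. 3.4 (i) with `T = {𝔭}`,
`H¹_f(K_𝔭, E[2]) = E[2]/(Frob_𝔭 − 1)E[2] = E[2]` (2-dimensional) and `V_T = loc_T(Sel₂(E))` ALL of it: then in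
Prop. 3.3 `0 ≤ dim V_T^F ≤ t − dim V_T = 0`, so `d₂(E^F) = d₂(E) − 2` — with NO parity input (Kramer's congruence is
needed only when `V_T` is not everything). In the Selmer-structure currency of X11b (`CongruentTransfer`: sandwich
`H¹_{𝓚_S} ≤ Sel(E), H¹_𝓐 ≤ H¹_{𝓚^S}`, Poitou–Tate count `[H¹_{𝓚^{v₀}} : H¹_{𝓚_{v₀}}] = #E(K_{v₀})[2]·#(𝓞/2)`,
transversality) this file proves, for every number field `K`:

* §0 `four_le_index_of_pair` (pure group theory: a subgroup `N ≤ K` killed by a homomorphism `f` taking on two elements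
  values `f a, f b` that span a Klein four-group has index `≥ 4`), `natCard_ker_nsmul_two_le_four` / `_pos` (local
  `2`-torsion of an elliptic curve over a characteristic-`0` field is finite, non-empty, of order `≤ 4`: injection into
  `E(F̄)[2]`, Silverman III.6.4).
* §1 **`natCard_selmerGroup_mul_four_eq_of_transverse_of_pair`** — congruent pair `Y[2] ≅ E[2]`, transported structure
  `𝓐 = φ_*𝓚_Y` agreeing with `𝓚_E` off ONE finite place `v₀ ∤ 2` and transverse to it at `v₀`; IF `Sel₂(E)` contains
  classes `x, y` with `loc_{v₀} x`, `loc_{v₀} y`, `loc_{v₀}(x+y)` non-zero and `loc_{v₀} x ≠ loc_{v₀} y`, THEN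
  `#Sel₂(Y)·4 = #Sel₂(E)` (and incidentally `#E(K_{v₀})[2] = 4`), modulo the two standard print facts
  `poitouTate_selmerStructure_duality_real K`, `localEulerPoincareCharacteristic` (exactly as gk2-p5's index-2 version
  `GenusKolyTwistLocal.natCard_selmerGroup_mul_eq_of_transverse_of_localization_ne_zero`, p620256). Proof: the four
  classes `0, x, y, x+y` have distinct images, so `[Sel(E) : H¹_{𝓚_{v₀}}] ≥ 4 ≥ t ≥ [H¹_{𝓚^{v₀}} : H¹_{𝓚_{v₀}}]`,
  forcing `Sel(E) = H¹_{𝓚^{v₀}}` and `t = 4`; transversality forces `H¹_𝓐 = H¹_{𝓚_{v₀}}`; count and transport.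
* §2 **`natCard_selmerGroup_twist_mul_four_eq_of_places`** — the quadratic-twist instance `Y = Wd ≅ W^{(d)}` with `W`
  good at `v₀ ∤ 2`, `v₀(d)` odd, the place menu of the lead's `natCard_selmerGroup_twist_mul_two_eq_of_places` (p622198:
  split ∨ both good `∤ 2` ∨ silent; split ∨ `H¹ = 0` at `∞`) and NO intertwining / transversality hypotheses (gk2-p5's
  `exists_intertwining_hsplit` + the lead's Lemma 2.11 `map_kummerLocalConditionAt_inf_eq_bot_of_twist_ramified`).

The `ℚ`-instance at `d = p ≡ 1 (mod 8N)` (place menu discharged) and Prop. 5.2 itself are the companion `…LoweringStep`.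

References: [MazurRubin2010] arXiv:0904.3709: Def. 3.1, Lemma 3.2, Prop. 3.3, Cor. 3.4 (i) (pp. 8–9), Prop. 5.2 (p. 12),
Lemmas 2.10–2.11 (pp. 6–7); [MilneADT2006] I Thm. 2.8, Thm. 4.10; [SilvermanAEC2009] Cor. III.6.4(b), X.§4.
-/

set_option linter.dupNamespace false -- tree convention: `Summit.BirchSwinnertonDyer.BirchSwinnertonDyer.Theorems` (summit = sub-problem)
set_option autoImplicit false

noncomputable section

open scoped Classical ContRepresentation

namespace Summit.BirchSwinnertonDyer.BirchSwinnertonDyer.Theorems.GenusKolyLowering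

open WeierstrassCurve Field NumberField IsDedekindDomain Function ValuativeRel
open Literature.NumberTheory.EllipticCurves Literature.NumberTheory.GaloisRepresentations
open Literature.NumberTheory.GaloisRepresentations.DiscreteGaloisModule (SelmerStructure)
open Literature.NumberTheory.GaloisCohomology
open Summit.BirchSwinnertonDyer.Rank1Residual.X11b.CongruentTransfer
open Summit.BirchSwinnertonDyer.Rank1Residual.X11b.SelmerCount (card_mul_relIndex_of_le)
open Summit.BirchSwinnertonDyer.Rank1Residual.X11b.KummerPT (kummerStrict kummerRelaxed kummerStrict_of_mem
  kummerStrict_of_not_mem)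
open Summit.BirchSwinnertonDyer.BirchSwinnertonDyer.Theorems.GenusKolyTwistLocal (natCard_quotient_span_natCast_eq_one_of_not_mem
  exists_intertwining_hsplit kummerLocalConditionAt_eq_top_of_forall_eq_zero map_kummerLocalConditionAt_eq_of_eq_top
  map_kummerLocalConditionAt_adicCompletion_eq_of_natCard_ker_eq_one)
open Summit.BirchSwinnertonDyer.BirchSwinnertonDyer.Theorems.GenusKolyTwistRamified
  (map_kummerLocalConditionAt_inf_eq_bot_of_twist_ramified)

/-! ## §0 Two counting lemmas -/

section Counting

/-- **A subgroup killed by `f` on which `f` spans a Klein four-group has index at least `4`.** If `N ≤ K` (index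
finite) lies in the kernel of `f : K → M` and `a, b ∈ K` have `f a ≠ 0`, `f b ≠ 0`, `f a ≠ f b`, `f a + f b ≠ 0`, then
the cosets of `0, a, b, a + b` are pairwise distinct, so `4 ≤ [K : N]`. [folklore] -/
theorem four_le_index_of_pair {K M : Type*} [AddCommGroup K] [AddCommGroup M] (N : AddSubgroup K)
    (f : K →+ M) (hN : ∀ k ∈ N, f k = 0) (hfin : N.index ≠ 0) {a b : K}
    (ha : f a ≠ 0) (hb : f b ≠ 0) (hab : f a ≠ f b) (hab' : f a + f b ≠ 0) : 4 ≤ N.index := by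
  classical
  haveI : Fintype (K ⧸ N) := AddSubgroup.fintypeOfIndexNeZero hfin
  have hq : ∀ k k' : K, f k ≠ f k' → (k : K ⧸ N) ≠ (k' : K ⧸ N) := by
    intro k k' hne heq
    apply hne
    have hmem : -k + k' ∈ N := QuotientAddGroup.eq.mp heq
    have h0 := hN _ hmem
    rw [map_add, map_neg, neg_add_eq_zero] at h0
    exact h0
  have h01 : ((0 : K) : K ⧸ N) ≠ (a : K ⧸ N) := hq 0 a (by rw [map_zero]; exact ha.symm)
  have h02 : ((0 : K) : K ⧸ N) ≠ (b : K ⧸ N) := hq 0 b (by rw [map_zero]; exact hb.symm)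
  have h03 : ((0 : K) : K ⧸ N) ≠ ((a + b : K) : K ⧸ N) :=
    hq 0 (a + b) (by rw [map_zero, map_add]; exact hab'.symm)
  have h12 : (a : K ⧸ N) ≠ (b : K ⧸ N) := hq a b hab
  have h13 : (a : K ⧸ N) ≠ ((a + b : K) : K ⧸ N) :=
    hq a (a + b) (by rw [map_add]; intro h; exact hb (left_eq_add.mp h))
  have h23 : (b : K ⧸ N) ≠ ((a + b : K) : K ⧸ N) :=
    hq b (a + b) (by rw [map_add]; intro h; exact ha (by simpa using h))
  set s : Finset (K ⧸ N) := {((0 : K) : K ⧸ N), (a : K ⧸ N), (b : K ⧸ N), ((a + b : K) : K ⧸ N)} with hs_def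
  have hs : s.card = 4 := by
    rw [hs_def, Finset.card_insert_of_notMem, Finset.card_insert_of_notMem, Finset.card_insert_of_notMem,
      Finset.card_singleton]
    · simp only [Finset.mem_singleton]
      exact h23
    · simp only [Finset.mem_insert, Finset.mem_singleton, not_or]
      exact ⟨h12, h13⟩
    · simp only [Finset.mem_insert, Finset.mem_singleton, not_or]
      exact ⟨h01, h02, h03⟩
  calc 4 = s.card := hs.symm
    _ ≤ Fintype.card (K ⧸ N) := Finset.card_le_univ s
    _ = N.index := by rw [AddSubgroup.index_eq_card, Nat.card_eq_fintype_card]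

/-- `ker [2] = E(F)[2]` as subgroups (the two spellings of the `2`-torsion). [folklore] -/
theorem ker_nsmulAddMonoidHom_eq_torsionBy {A : Type*} [AddCommGroup A] (n : ℕ) :
    (nsmulAddMonoidHom n : A →+ A).ker = AddSubgroup.torsionBy A (n : ℤ) := by
  ext P
  rw [AddMonoidHom.mem_ker, nsmulAddMonoidHom_apply, AddSubgroup.torsionBy, Submodule.mem_toAddSubgroup,
    Submodule.mem_torsionBy_iff, natCast_zsmul]

/-- **`E(F)[2]` is finite of order `≤ 4` over a field of characteristic `0`** (injection into `E(F̄)[2]`, which has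
`4` elements: Silverman III.6.4(b)). [cite: SilvermanAEC2009, Cor. III.6.4(b)] -/
theorem finite_and_natCard_ker_nsmul_two_le_four {F : Type*} [Field F] [CharZero F] (V : WeierstrassCurve F)
    [V.IsElliptic] :
    Finite (nsmulAddMonoidHom 2 : V.toAffine.Point →+ V.toAffine.Point).ker ∧
      Nat.card (nsmulAddMonoidHom 2 : V.toAffine.Point →+ V.toAffine.Point).ker ≤ 4 := by
  let L := AlgebraicClosure F
  haveI : CharZero L := charZero_of_injective_algebraMap (algebraMap F L).injective
  have h2L : ((2 : ℕ) : L) ≠ 0 := by norm_num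
  have hcard : Nat.card (AddSubgroup.torsionBy (V.baseChange L).toAffine.Point ((2 : ℕ) : ℤ)) = 2 ^ 2 :=
    card_torsionBy_eq_sq (E := V.baseChange L) h2L
  haveI : Finite (AddSubgroup.torsionBy (V.baseChange L).toAffine.Point ((2 : ℕ) : ℤ)) :=
    Nat.finite_of_card_ne_zero (by rw [hcard]; norm_num)
  let ι : V.toAffine.Point →+ (V.baseChange L).toAffine.Point :=
    Affine.Point.baseChange (W' := V.toAffine) F L
  have hι : Function.Injective ι := Affine.Point.map_injective _
  let ι' : (nsmulAddMonoidHom 2 : V.toAffine.Point →+ V.toAffine.Point).ker →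
      AddSubgroup.torsionBy (V.baseChange L).toAffine.Point ((2 : ℕ) : ℤ) := fun x ↦
    ⟨ι x, AddSubgroup.torsionBy.nsmul_iff.mpr (by
      have hx : 2 • (x : V.toAffine.Point) = 0 := by
        have := x.2; rwa [AddMonoidHom.mem_ker, nsmulAddMonoidHom_apply] at this
      rw [← map_nsmul, hx, map_zero])⟩
  have hι' : Function.Injective ι' := fun x y h ↦ Subtype.ext (hι (congrArg Subtype.val h))
  exact ⟨Finite.of_injective ι' hι', by
    have h := Nat.card_le_card_of_injective ι' hι'; rw [hcard] at h; exact h⟩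

/-- `#E(F)[2] ≠ 0` (finite and contains `O`). [cite: SilvermanAEC2009, Cor. III.6.4(b)] -/
theorem natCard_ker_nsmul_two_ne_zero {F : Type*} [Field F] [CharZero F] (V : WeierstrassCurve F) [V.IsElliptic] :
    Nat.card (nsmulAddMonoidHom 2 : V.toAffine.Point →+ V.toAffine.Point).ker ≠ 0 := by
  haveI := (finite_and_natCard_ker_nsmul_two_le_four V).1
  exact Nat.card_pos.ne'

end Counting

/-! ## §1 The DOWN-by-two transfer for a congruent pair with one transverse place where `loc(Sel)` is 2-dimensional -/

section Down

variable {K : Type} [Field K] [NumberField K] (W Y : WeierstrassCurve K) [W.IsElliptic]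

/-- **Mazur–Rubin Cor. 3.4 (i) with `dim V_T = 2` for a congruent pair `Y[2] ≅ E[2]` over a number field `K`
(`#Sel₂(Y) · 4 = #Sel₂(E)`).** HYPOTHESES: the print facts `poitouTate_selmerStructure_duality_real K` (Milne ADT I.4.10
with real places) and `localEulerPoincareCharacteristic K_v` (Tate) — as in X11b's one-place count; inverse
`Γ_K`-intertwining maps `φ : Y[2] → E[2]`, `ψ`; the transported Kummer structure `𝓐 = φ_*𝓚_Y` (`h𝓐`); one finite place
`v₀ ∤ 2` such that `𝓐` AGREES with `𝓚_E` at every other place and is TRANSVERSE to it at `v₀`; and two classes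
`x, y ∈ Sel₂(E)` whose localisations at `v₀` satisfy `loc x ≠ 0`, `loc y ≠ 0`, `loc x ≠ loc y`, `loc (x+y) ≠ 0`
(`loc_{v₀}` maps `Sel₂(E)` onto a Klein four-group — all of `H¹_f(K_{v₀}, E[2])`). CONCLUSION: `#Sel₂(Y) · 4 = #Sel₂(E)`.
Proof: `[Sel(E) : H¹_{𝓚_{v₀}}] ≥ 4` (§0) while `[H¹_{𝓚^{v₀}} : H¹_{𝓚_{v₀}}] = #E(K_{v₀})[2] ≤ 4` (Poitou–Tate count, §0),
so `Sel(E) = H¹_{𝓚^{v₀}}` of index exactly `4` over the strict group; every class of `H¹_𝓐 ≤ H¹_{𝓚^{v₀}} = Sel(E)`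
localises into `𝓐_{v₀} ⊓ 𝓚_{v₀} = ⊥`, so `H¹_𝓐 = H¹_{𝓚_{v₀}}`; transport `#H¹_𝓐 = #Sel(Y)`. Printed (Prop. 3.3 ⟹
Cor. 3.4 (i)): «`d₂(E^F/K) = d₂(E/K) − dim V_T + d` for some `0 ≤ d ≤ dim(⊕ H¹_f/V_T)`», here `= 0`.
[cite: MazurRubin2010, Prop. 3.3, Cor. 3.4 (i) and proof of Prop. 5.2 (arXiv:0904.3709 pp. 8–9, 12)]
[cite: MilneADT2006, Ch. I, Thm. 4.10] -/
theorem natCard_selmerGroup_mul_four_eq_of_transverse_of_pair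
    (hPT : poitouTate_selmerStructure_duality_real K)
    (hEP : ∀ v : HeightOneSpectrum (𝓞 K), localEulerPoincareCharacteristic (v.adicCompletion K))
    (φ : (Y.torsionGaloisModule ((2 : ℕ) : ℤ)).toContRepresentation →ⁱL
      (W.torsionGaloisModule ((2 : ℕ) : ℤ)).toContRepresentation)
    (ψ : (W.torsionGaloisModule ((2 : ℕ) : ℤ)).toContRepresentation →ⁱL
      (Y.torsionGaloisModule ((2 : ℕ) : ℤ)).toContRepresentation)
    (hψφ : ∀ a, ψ (φ a) = a) (hφψ : ∀ b, φ (ψ b) = b)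
    (𝓐 : SelmerStructure (W.torsionGaloisModule ((2 : ℕ) : ℤ)))
    (h𝓐 : ∀ v, 𝓐 v = (Y.kummerSelmerStructure ((2 : ℕ) : ℤ) v).map
      (galoisCohomology.map (φ.restrictField (Place.Completion v)) 1))
    (v₀ : HeightOneSpectrum (𝓞 K)) (hv₀ : ((2 : ℕ) : 𝓞 K) ∉ v₀.asIdeal)
    (hagree : ∀ v : Place K, v ≠ Sum.inr v₀ → 𝓐 v = W.kummerSelmerStructure ((2 : ℕ) : ℤ) v)
    (htr : 𝓐 (Sum.inr v₀) ⊓ W.kummerSelmerStructure ((2 : ℕ) : ℤ) (Sum.inr v₀) = ⊥)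
    (hpair : ∃ x ∈ (W.kummerSelmerStructure ((2 : ℕ) : ℤ)).selmerGroup,
      ∃ y ∈ (W.kummerSelmerStructure ((2 : ℕ) : ℤ)).selmerGroup,
        galoisCohomology.localization (W.torsionGaloisModule ((2 : ℕ) : ℤ)) (Sum.inr v₀) 1 x ≠ 0 ∧
        galoisCohomology.localization (W.torsionGaloisModule ((2 : ℕ) : ℤ)) (Sum.inr v₀) 1 y ≠ 0 ∧
        galoisCohomology.localization (W.torsionGaloisModule ((2 : ℕ) : ℤ)) (Sum.inr v₀) 1 x ≠
          galoisCohomology.localization (W.torsionGaloisModule ((2 : ℕ) : ℤ)) (Sum.inr v₀) 1 y ∧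
        galoisCohomology.localization (W.torsionGaloisModule ((2 : ℕ) : ℤ)) (Sum.inr v₀) 1 (x + y) ≠ 0) :
    Nat.card (Y.selmerGroup ((2 : ℕ) : ℤ)) * 4 = Nat.card (W.selmerGroup ((2 : ℕ) : ℤ)) := by
  haveI : Fact (Nat.Prime 2) := ⟨Nat.prime_two⟩
  haveI : CharZero (v₀.adicCompletion K) :=
    charZero_of_injective_algebraMap (algebraMap K (v₀.adicCompletion K)).injective
  set S : Finset (Place K) := {(Sum.inr v₀ : Place K)} with hS
  have hv₀S : (Sum.inr v₀ : Place K) ∈ S := by simp [hS]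
  have hagreeS : ∀ v ∉ S, 𝓐 v = W.kummerSelmerStructure ((2 : ℕ) : ℤ) v := fun v hv ↦
    hagree v (by simpa [hS] using hv)
  set loc := galoisCohomology.localization (W.torsionGaloisModule ((2 : ℕ) : ℤ)) (Sum.inr v₀) 1 with hloc
  -- the two sandwiches
  obtain ⟨hAlo, hAhi⟩ := selmerGroup_sandwich_of_agree W 2 S hagreeS
  obtain ⟨hKlo, hKhi⟩ := selmerGroup_sandwich_kummer W 2 S
  set H₁ := (kummerStrict W 2 S).selmerGroup with hH₁
  set H₂ := (kummerRelaxed W 2 S).selmerGroup with hH₂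
  set Sel := (W.kummerSelmerStructure ((2 : ℕ) : ℤ)).selmerGroup with hSel
  -- the index `t = [H₂ : H₁] = #E(K_{v₀})[2] ≤ 4`, `t ≠ 0`
  set t := Nat.card (nsmulAddMonoidHom 2 : (W.baseChange (v₀.adicCompletion K)).toAffine.Point →+ _).ker with ht
  have hidx : H₁.relIndex H₂ = t := by
    rw [hH₁, hH₂, hS, relIndex_kummerStrict_kummerRelaxed_singleton_eq_of_facts W 2 hPT hEP v₀,
      natCard_quotient_span_natCast_eq_one_of_not_mem v₀ hv₀, mul_one]
  have ht4 : t ≤ 4 := (finite_and_natCard_ker_nsmul_two_le_four (W.baseChange (v₀.adicCompletion K))).2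
  have ht0 : t ≠ 0 := natCard_ker_nsmul_two_ne_zero (W.baseChange (v₀.adicCompletion K))
  -- `[Sel : H₁] ≥ 4`
  obtain ⟨x, hxS, y, hyS, hx0, hy0, hxy, hxy0⟩ := hpair
  have hstrict0 : ∀ c ∈ H₁, loc c = 0 := fun c hc ↦ by
    have h := (SelmerStructure.mem_selmerGroup_iff _ _).mp hc (Sum.inr v₀)
    rwa [kummerStrict_of_mem W 2 S hv₀S, AddSubgroup.mem_bot] at h
  have hmul := AddSubgroup.relIndex_mul_relIndex H₁ Sel H₂ hKlo hKhi
  rw [hidx] at hmul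
  have h4 : 4 ≤ H₁.relIndex Sel := by
    have hne : (H₁.addSubgroupOf Sel).index ≠ 0 := by
      intro h0
      have : H₁.relIndex Sel = 0 := h0
      rw [this, zero_mul] at hmul
      exact ht0 hmul.symm
    have h := four_le_index_of_pair (H₁.addSubgroupOf Sel) (loc.comp Sel.subtype)
      (fun k hk ↦ hstrict0 _ (AddSubgroup.mem_addSubgroupOf.mp hk)) hne
      (a := ⟨x, hxS⟩) (b := ⟨y, hyS⟩)
      (by simpa using hx0) (by simpa using hy0) (by simpa using hxy) (by simpa [← map_add] using hxy0)
    exact h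
  -- hence `Sel = H₂` and `t = 4`
  have hb : Sel.relIndex H₂ = 1 := by
    rcases Nat.eq_zero_or_pos (Sel.relIndex H₂) with h0 | hpos
    · rw [h0, mul_zero] at hmul; exact absurd hmul.symm ht0
    · by_contra h1
      have h2 : 2 ≤ Sel.relIndex H₂ := by omega
      have : 4 * 2 ≤ t := by rw [← hmul]; exact Nat.mul_le_mul h4 h2
      omega
  have ht : t = 4 := by
    rw [hb, mul_one] at hmul
    omega
  have hK : Sel = H₂ := le_antisymm hKhi (AddSubgroup.relIndex_eq_one.mp hb)
  -- `H¹_𝓐 = H₁` (transversality)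
  have hA : 𝓐.selmerGroup = H₁ := by
    refine le_antisymm (fun c hc ↦ ?_) hAlo
    have hcSel : c ∈ Sel := by rw [hK]; exact hAhi hc
    have hc0 : loc c = 0 := by
      have h𝓐v := (SelmerStructure.mem_selmerGroup_iff _ _).mp hc (Sum.inr v₀)
      have hKv := (SelmerStructure.mem_selmerGroup_iff _ _).mp hcSel (Sum.inr v₀)
      have hbot : loc c ∈ 𝓐 (Sum.inr v₀) ⊓ W.kummerSelmerStructure ((2 : ℕ) : ℤ) (Sum.inr v₀) :=
        AddSubgroup.mem_inf.mpr ⟨h𝓐v, hKv⟩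
      rw [htr, AddSubgroup.mem_bot] at hbot
      exact hbot
    refine (SelmerStructure.mem_selmerGroup_iff _ _).mpr fun v ↦ ?_
    by_cases hv : v ∈ S
    · have hv' : v = Sum.inr v₀ := by simpa [hS] using hv
      rw [kummerStrict_of_mem W 2 S hv, hv', AddSubgroup.mem_bot]
      exact hc0
    · rw [kummerStrict_of_not_mem W 2 S hv]
      exact (SelmerStructure.mem_selmerGroup_iff _ _).mp hcSel v
  -- counting
  have hcount := card_mul_relIndex_of_le (hKlo.trans hKhi)
  rw [hidx, ht, ← hA, ← hK] at hcount
  rw [← natCard_selmerGroup_transport_kummer W Y 2 φ ψ hψφ hφψ 𝓐 h𝓐,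
    selmerGroup_eq_selmerGroup_kummerSelmerStructure]
  exact hcount

end Down

/-! ## §2 The quadratic-twist instance with the place menu (no intertwining, no transversality hypotheses) -/

section Twist

variable {K : Type} [Field K] [NumberField K] (W : WeierstrassCurve K) [W.IsElliptic]

/-- **Mazur–Rubin Cor. 3.4 (i), DOWN BY TWO, for the twist pair `(E, E^{(d)})` at `p = 2` — place-menu form.** For
`W` elliptic over a number field `K` with good reduction at a finite `v₀ ∤ 2`, `d ≠ 0` with `v₀(d)` odd (`d = c²π`,
`π` a uniformiser at `v₀`), and ANY elliptic model `Wd` of `W^{(d)}`: IF every finite `v ≠ v₀` is split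
(`d ∈ (K_v^×)²`) or good for both curves with `v ∤ 2` or silent (`v ∤ 2`, no `K_v`-rational `2`-torsion on either
curve), every infinite place is split or has `H¹(K_w, ·) = 0` for both curves, and `Sel₂(W)` contains two classes
`x, y` with `loc_{v₀} x, loc_{v₀} y, loc_{v₀}(x + y)` non-zero and `loc_{v₀} x ≠ loc_{v₀} y`, THEN
`#Sel₂(Wd) · 4 = #Sel₂(W)` — granted only `poitouTate_selmerStructure_duality_real K` and
`localEulerPoincareCharacteristic`. (Intertwining pair and split-place agreement: gk2-p5's `exists_intertwining_hsplit`;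
transversality at `v₀`: the lead's Lemma 2.11 `map_kummerLocalConditionAt_inf_eq_bot_of_twist_ramified`, p622198.)
This is the Selmer computation in the proof of Prop. 5.2 («Corollary 3.4(i) now yields `d₂(E^F/K) = d₂(E/K) − 2`»).
[cite: MazurRubin2010, Lemmas 2.10–2.11, Prop. 3.3, Cor. 3.4 (i), Prop. 5.2 (arXiv:0904.3709 pp. 6–9, 12)]
[cite: MilneADT2006, Ch. I, Thm. 2.8 and Thm. 4.10] -/
theorem natCard_selmerGroup_twist_mul_four_eq_of_places
    (hPT : poitouTate_selmerStructure_duality_real K)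
    (hEP : ∀ v : HeightOneSpectrum (𝓞 K), localEulerPoincareCharacteristic (v.adicCompletion K))
    {d : K} (hd : d ≠ 0) {Wd : WeierstrassCurve K} [Wd.IsElliptic] {C : VariableChange K}
    (hWd : C • W.quadraticTwist d = Wd)
    (v₀ : HeightOneSpectrum (𝓞 K)) (hv₀ : ((2 : ℕ) : 𝓞 K) ∉ v₀.asIdeal) (hW : W.HasGoodReductionAt v₀)
    (hram : ∃ π c : K, v₀.valuation K π = WithZero.exp (-1 : ℤ) ∧ d = c ^ 2 * π)
    (hfin : ∀ v : HeightOneSpectrum (𝓞 K), v ≠ v₀ →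
      (∃ s : v.adicCompletion K, s ^ 2 = algebraMap K (v.adicCompletion K) d) ∨
      (((2 : ℕ) : 𝓞 K) ∉ v.asIdeal ∧ W.HasGoodReductionAt v ∧ Wd.HasGoodReductionAt v) ∨
      (((2 : ℕ) : 𝓞 K) ∉ v.asIdeal ∧
        Nat.card (nsmulAddMonoidHom 2 : (W.baseChange (v.adicCompletion K)).toAffine.Point →+ _).ker = 1 ∧
        Nat.card (nsmulAddMonoidHom 2 : (Wd.baseChange (v.adicCompletion K)).toAffine.Point →+ _).ker = 1))
    (hinf : ∀ w : InfinitePlace K,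
      (∃ s : w.Completion, s ^ 2 = algebraMap K w.Completion d) ∨
      ((∀ x : galoisCohomology (W.localGaloisModule w.Completion) 1, x = 0) ∧
        (∀ x : galoisCohomology (Wd.localGaloisModule w.Completion) 1, x = 0)))
    (hpair : ∃ x ∈ (W.kummerSelmerStructure ((2 : ℕ) : ℤ)).selmerGroup,
      ∃ y ∈ (W.kummerSelmerStructure ((2 : ℕ) : ℤ)).selmerGroup,
        galoisCohomology.localization (W.torsionGaloisModule ((2 : ℕ) : ℤ)) (Sum.inr v₀) 1 x ≠ 0 ∧
        galoisCohomology.localization (W.torsionGaloisModule ((2 : ℕ) : ℤ)) (Sum.inr v₀) 1 y ≠ 0 ∧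
        galoisCohomology.localization (W.torsionGaloisModule ((2 : ℕ) : ℤ)) (Sum.inr v₀) 1 x ≠
          galoisCohomology.localization (W.torsionGaloisModule ((2 : ℕ) : ℤ)) (Sum.inr v₀) 1 y ∧
        galoisCohomology.localization (W.torsionGaloisModule ((2 : ℕ) : ℤ)) (Sum.inr v₀) 1 (x + y) ≠ 0) :
    Nat.card (Wd.selmerGroup ((2 : ℕ) : ℤ)) * 4 = Nat.card (W.selmerGroup ((2 : ℕ) : ℤ)) := by
  haveI : NeZero (2 : K) := ⟨by norm_num⟩
  obtain ⟨φ, ψ, hψφ, hφψ, hsplit⟩ := exists_intertwining_hsplit W hd hWd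
  -- the transported Kummer structure of `Wd`
  let 𝓐 : SelmerStructure (W.torsionGaloisModule ((2 : ℕ) : ℤ)) := fun v ↦
    (Wd.kummerSelmerStructure ((2 : ℕ) : ℤ) v).map
      (galoisCohomology.map (φ.restrictField (Place.Completion v)) 1)
  have h𝓐 : ∀ v, 𝓐 v = (Wd.kummerSelmerStructure ((2 : ℕ) : ℤ) v).map
      (galoisCohomology.map (φ.restrictField (Place.Completion v)) 1) := fun _ ↦ rfl
  refine natCard_selmerGroup_mul_four_eq_of_transverse_of_pair W Wd hPT hEP φ ψ hψφ hφψ 𝓐 h𝓐 v₀ hv₀ ?_ ?_ hpair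
  · -- agreement at every place other than `v₀`
    rintro (w | v) hv
    · rcases hinf w with ⟨s, hs⟩ | ⟨hW', hWd'⟩
      · rw [h𝓐, kummerSelmerStructure_apply, kummerSelmerStructure_apply]
        exact hsplit (Place.Completion (Sum.inl w)) ⟨s, hs⟩
      · rw [h𝓐, kummerSelmerStructure_apply, kummerSelmerStructure_apply]
        exact map_kummerLocalConditionAt_eq_of_eq_top W Wd ((2 : ℕ) : ℤ) (Place.Completion (Sum.inl w)) φ ψ hφψ
          (kummerLocalConditionAt_eq_top_of_forall_eq_zero Wd _ _ hWd')
          (kummerLocalConditionAt_eq_top_of_forall_eq_zero W _ _ hW')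
    · have hvv₀ : v ≠ v₀ := fun h ↦ hv (by rw [h])
      rcases hfin v hvv₀ with ⟨s, hs⟩ | ⟨h2v, hvW, hvWd⟩ | ⟨h2v, h1W, h1Wd⟩
      · rw [h𝓐, kummerSelmerStructure_apply, kummerSelmerStructure_apply]
        exact hsplit (Place.Completion (Sum.inr v)) ⟨s, hs⟩
      · exact transport_kummer_inr_eq_of_good W Wd 2 φ ψ hφψ 𝓐 h𝓐 h2v hvW hvWd
      · rw [h𝓐, kummerSelmerStructure_apply, kummerSelmerStructure_apply]
        exact map_kummerLocalConditionAt_adicCompletion_eq_of_natCard_ker_eq_one W Wd v two_ne_zero h2v h1W h1Wd φ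
  · -- transversality at `v₀` (Lemma 2.11)
    rw [h𝓐, kummerSelmerStructure_apply, kummerSelmerStructure_apply]
    exact map_kummerLocalConditionAt_inf_eq_bot_of_twist_ramified W hd hWd v₀ hv₀ hW hram φ ψ hψφ

end Twist

end Summit.BirchSwinnertonDyer.BirchSwinnertonDyer.Theorems.GenusKolyLowering

end
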